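import Summits.QuantumFields.YangMills.Theses.LuscherReduction

/-! # Sketch — crux idea `block-endpoint` (crux-ideate #2, GEN 3) on stmt-QuantumFields-20205 `LuscherReduction.DressedRitz`

Scratch signatures only (no statement of record, no sorry).  The crux is FIXED: `Theses.LuscherReduction.DressedRitz`.

* `blockIter β ℓ m ψ = K_β^{mℓ} ψ` — the BLOCK transfer operator `P = K_β^ℓ` applied `m` times (`ℓ` = temporal block length in fine steps);
* `blockCorr β ℓ m ψ φ = ⟨ψ, K_β^{mℓ} φ⟩` — a block-aligned two-point number;
* `BlockDefectLE β ℓ δ ψ` — the `P`-defect bound `⟨ψ,P²ψ⟩⟨ψ,ψ⟩ ≤ (1+δ)⟨ψ,Pψ⟩²`;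
* `BlockToFine` — FIRST LEMMA of the line (pure spectral calculus of `0 ≤ K ≤ ‖K‖`, `K = (K^ℓ)^{1/ℓ}`): for a once-dressed vector
  `ψ = Pψ₀` whose pre-image and itself have `P`-defect `≤ δ ≤ 1/8`:  (a) Jensen root `q_K(ψ)^ℓ ≤ q_P(ψ)`, (b) root lower bound
  `q_P(ψ) ≤ e^{c₀δ} q_K(ψ)^ℓ`, (c) DEFECT CONTRACTION `D_K(ψ) ≤ c₀ δ / ℓ²` — absolute `c₀`;
* `CrossSecondOrder` — SECOND LEMMA: for an exact block-level Ritz pair the fine cross term `⟨Φ,KΦ'⟩` is second order,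
  `O((δ + σ√δ)/ℓ)` — so the door needs no fine-time cross data;
* `BlockPlateau` — the transfer target `C⁺` (block currency): a physical family `Ψ̃_0 … Ψ̃_k` (Ψ̃_0 ↦ the vacuum) whose block-aligned
  two-point numbers at block times `0 … 4` form an exact block-level Ritz family with two-sided block Rayleigh `e^{±CΛ²}` against the
  one-site levels to the `ℓ`-th power and block defects `≤ CΛ³`, with `L ≤ C ℓ`;
* `BlockDoor := BlockPlateau → DressedRitz` (the block-aligned door; M, spectral theory + the tree's Ritz rotation).

HONEST FRAMING: femto-universe infrastructure for the conditional rung R2b1; nothing here bears on infinite volume or the Clay gap. -/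

open MeasureTheory
open Literature.MathematicalPhysics.QuantumFieldTheory
open Summit.QuantumFields.YangMills.Theorems.FemtoTransferGap

namespace Summit.QuantumFields.YangMills.Cruxes.DressedRitz.BlockEndpoint

/-- `K_β^{mℓ} ψ`: the block transfer operator `P = K_β^ℓ` applied `m` times. [folklore] -/
noncomputable def blockIter {L : ℕ} [NeZero L] (β : ℝ) (ℓ m : ℕ) (ψ : GaugeConfig 3 L SU2 → ℝ) :
    GaugeConfig 3 L SU2 → ℝ :=
  (transferApply (L := L) β)^[m * ℓ] ψ

/-- `⟨ψ, K_β^{mℓ} φ⟩` — block-aligned two-point number (an OS two-point function of two block observables `m` blocks apart). [folklore] -/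
noncomputable def blockCorr {L : ℕ} [NeZero L] (β : ℝ) (ℓ m : ℕ) (ψ φ : GaugeConfig 3 L SU2 → ℝ) : ℝ :=
  l2 ψ (blockIter β ℓ m φ)

/-- `P`-defect bound `⟨ψ,P²ψ⟩⟨ψ,ψ⟩ ≤ (1+δ)⟨ψ,Pψ⟩²` (`P = K_β^ℓ`): relative variance of `λ^ℓ` under the spectral measure of `ψ`. [folklore] -/
def BlockDefectLE {L : ℕ} [NeZero L] (β : ℝ) (ℓ : ℕ) (δ : ℝ) (ψ : GaugeConfig 3 L SU2 → ℝ) : Prop :=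
  blockCorr β ℓ 2 ψ ψ * blockCorr β ℓ 0 ψ ψ ≤ (1 + δ) * blockCorr β ℓ 1 ψ ψ ^ 2

/-- **FIRST LEMMA (block-to-fine transfer).**  `K = K_β ≥ 0` bounded self-adjoint on the physical subspace (tree: `qform_self_nonneg_…`,
`l2_transferApply_comm`), `P = K^ℓ`, `ψ = P ψ₀`.  If the `P`-defects of `ψ₀` and of `ψ` are `≤ δ ≤ 1/8` then, with an ABSOLUTE `c₀`:
(a) `⟨ψ,Kψ⟩^ℓ ≤ ⟨ψ,Pψ⟩ ⟨ψ,ψ⟩^{ℓ-1}` (power-mean / Jensen on the spectral measure);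
(b) `⟨ψ,Pψ⟩ ⟨ψ,ψ⟩^{ℓ-1} ≤ e^{c₀δ} ⟨ψ,Kψ⟩^ℓ` (centre at the dressed mean: the first-order term vanishes, `E[u] = E[e^{-u}-1+u] ≤ cδ`);
(c) `⟨Kψ,Kψ⟩⟨ψ,ψ⟩ ≤ (1 + c₀δ/ℓ²) ⟨ψ,Kψ⟩²` — the fine defect is the block defect divided by `ℓ²`
(near components: `ℓ(e^{u/ℓ}-1) ≤ e^u-1`; far components: Chebyshev weight `≤ 4δ` for `ψ₀`, times the dressing factor `e^{-2s}`, times `(s/ℓ)²`).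
[cite: ReedSimonIV1978, Thm. XIII.1] [folklore: power-mean inequality] -/
def BlockToFine : Prop :=
  ∃ c₀ : ℝ, 0 < c₀ ∧ ∀ (L : ℕ) [NeZero L] (β δ : ℝ) (ℓ : ℕ), 1 ≤ β → 1 ≤ ℓ → 0 ≤ δ → δ ≤ 1 / 8 →
    ∀ ψ₀ : GaugeConfig 3 L SU2 → ℝ, IsPhys ψ₀ → 0 < blockCorr β ℓ 1 (blockIter β ℓ 1 ψ₀) (blockIter β ℓ 1 ψ₀) →
      BlockDefectLE β ℓ δ ψ₀ → BlockDefectLE β ℓ δ (blockIter β ℓ 1 ψ₀) →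
        qform su2Rep β (blockIter β ℓ 1 ψ₀) (blockIter β ℓ 1 ψ₀) ^ ℓ
            ≤ blockCorr β ℓ 1 (blockIter β ℓ 1 ψ₀) (blockIter β ℓ 1 ψ₀)
              * l2 (blockIter β ℓ 1 ψ₀) (blockIter β ℓ 1 ψ₀) ^ (ℓ - 1) ∧
        blockCorr β ℓ 1 (blockIter β ℓ 1 ψ₀) (blockIter β ℓ 1 ψ₀) * l2 (blockIter β ℓ 1 ψ₀) (blockIter β ℓ 1 ψ₀) ^ (ℓ - 1)
            ≤ Real.exp (c₀ * δ) * qform su2Rep β (blockIter β ℓ 1 ψ₀) (blockIter β ℓ 1 ψ₀) ^ ℓ ∧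
        l2 (transferApply β (blockIter β ℓ 1 ψ₀)) (transferApply β (blockIter β ℓ 1 ψ₀))
              * l2 (blockIter β ℓ 1 ψ₀) (blockIter β ℓ 1 ψ₀)
            ≤ (1 + c₀ * δ / (ℓ : ℝ) ^ 2) * qform su2Rep β (blockIter β ℓ 1 ψ₀) (blockIter β ℓ 1 ψ₀) ^ 2

/-- **SECOND LEMMA (cross terms are second order).**  Two once-dressed physical vectors `Φ = Pψ₀`, `Φ' = Pφ₀` that are EXACTLY
`l2`-orthogonal and `P`-orthogonal (a block-level Ritz family — obtainable from block data alone by a finite GEVP), with `P`-defects `≤ δ`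
(raw and dressed) and block Rayleigh quotients `σ`-close, have fine cross term
`|⟨Φ,KΦ'⟩| ≤ c₀ (δ + σ√δ)/ℓ · √(⟨Φ,KΦ⟩⟨Φ',KΦ'⟩)`: expand `X ↦ X^{1/ℓ}` affinely at one centre — the constant and linear terms integrate
to `0` against the cross spectral measure (`∫dν_ij = ∫X dν_ij = 0`), the remainder is `≤ (X/Q-1)²/ℓ` on `X ≥ Q/2` and is dressed away
below (`|ν_ij| ≤ ½(tν_ii + ν_jj/t)`).  Hence NO fine-time cross data is needed by the door. [cite: ReedSimonIV1978, Thm. XIII.1] [folklore] -/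
def CrossSecondOrder : Prop :=
  ∃ c₀ : ℝ, 0 < c₀ ∧ ∀ (L : ℕ) [NeZero L] (β δ σ : ℝ) (ℓ : ℕ), 1 ≤ β → 1 ≤ ℓ → 0 ≤ δ → δ ≤ 1 / 8 → 0 ≤ σ → σ ≤ 1 / 8 →
    ∀ ψ₀ φ₀ : GaugeConfig 3 L SU2 → ℝ, IsPhys ψ₀ → IsPhys φ₀ →
      0 < blockCorr β ℓ 1 (blockIter β ℓ 1 ψ₀) (blockIter β ℓ 1 ψ₀) → 0 < blockCorr β ℓ 1 (blockIter β ℓ 1 φ₀) (blockIter β ℓ 1 φ₀) →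
      BlockDefectLE β ℓ δ ψ₀ → BlockDefectLE β ℓ δ (blockIter β ℓ 1 ψ₀) →
      BlockDefectLE β ℓ δ φ₀ → BlockDefectLE β ℓ δ (blockIter β ℓ 1 φ₀) →
      -- exact block-level Ritz pair
      l2 (blockIter β ℓ 1 ψ₀) (blockIter β ℓ 1 φ₀) = 0 → blockCorr β ℓ 1 (blockIter β ℓ 1 ψ₀) (blockIter β ℓ 1 φ₀) = 0 →
      -- block Rayleigh quotients σ-close:  |q_P(Φ) - q_P(Φ')| ≤ σ q_P(Φ')
      |blockCorr β ℓ 1 (blockIter β ℓ 1 ψ₀) (blockIter β ℓ 1 ψ₀) * l2 (blockIter β ℓ 1 φ₀) (blockIter β ℓ 1 φ₀)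
          - blockCorr β ℓ 1 (blockIter β ℓ 1 φ₀) (blockIter β ℓ 1 φ₀) * l2 (blockIter β ℓ 1 ψ₀) (blockIter β ℓ 1 ψ₀)|
        ≤ σ * (blockCorr β ℓ 1 (blockIter β ℓ 1 φ₀) (blockIter β ℓ 1 φ₀) * l2 (blockIter β ℓ 1 ψ₀) (blockIter β ℓ 1 ψ₀)) →
      |qform su2Rep β (blockIter β ℓ 1 ψ₀) (blockIter β ℓ 1 φ₀)|
        ≤ c₀ * (δ + σ * Real.sqrt δ) / (ℓ : ℝ)
            * Real.sqrt (qform su2Rep β (blockIter β ℓ 1 ψ₀) (blockIter β ℓ 1 ψ₀)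
                * qform su2Rep β (blockIter β ℓ 1 φ₀) (blockIter β ℓ 1 φ₀))

/-- **Transfer target `C⁺` (block currency).**  For every `k`, eventually along every femto window, there are a block length `ℓ` with
`L ≤ C ℓ` (ℓ = L/b, `b < M²` the bounded endpoint side) and a physical family `Ψ̃_0 … Ψ̃_k` — INTENDED: `Ψ̃_0` = the vacuum, `Ψ̃_{i}` = the
OS-image of the centre-invariant zero-mode function `χ·f_{i}/f_0` of Bałaban's iterated block average on ONE past time-block — such that,
writing `Ψ_i := P Ψ̃_i` (`P = K_β^ℓ`), `Λ = luscherLambda β L`, `μ_j = levelValue su2Rep 1 (oneSiteCoupling β L) j`: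
(b0) `Ψ_0` is a top Rayleigh maximiser; (b1) `{Ψ_i}` is an EXACT block-level Ritz family (`l2`- and `P`-orthogonal — WLOG, a finite GEVP on
block data); (b2) two-sided BLOCK Rayleigh match
`q_P(Ψ_j)/q_P(Ψ_0) = (μ_j/μ_0)^ℓ e^{±CΛ²}`; (b3) block defects of `Ψ̃_j` and `Ψ_j` `≤ CΛ³ ≤ 1/8`.  Every number here is a block-aligned
two-point function = an integral against the RG's own endpoint density (δ-function RG transports block observables exactly).
[cite: Balaban1985Averaging, (10)–(11)] [cite: Balaban1987RG1, (1.3),(1.6),(1.18),(1.19)] [cite: Luscher1983, §1] -/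
def BlockPlateau : Prop :=
  ∀ k : ℕ, ∃ C lam0 : ℝ, 0 < lam0 ∧ ∀ lam : ℝ, 0 < lam → lam ≤ lam0 → ∃ L0 : ℕ, ∀ (L : ℕ) [NeZero L], L0 ≤ L → ∀ β : ℝ,
    InFemtoWindow lam β L →
      ∃ ℓ : ℕ, 1 ≤ ℓ ∧ (L : ℝ) ≤ C * ℓ ∧
      ∃ Ψ : Fin (k + 1) → (GaugeConfig 3 L SU2 → ℝ),
        (∀ i, IsPhys (Ψ i)) ∧ (∀ i, 0 < l2 (blockIter β ℓ 1 (Ψ i)) (blockIter β ℓ 1 (Ψ i))) ∧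
        -- (b0) the dressed `Ψ 0` is a top Rayleigh maximiser (exact vacuum ⇒ top capture is η-free)
        (∀ ψ : GaugeConfig 3 L SU2 → ℝ, IsPhys ψ →
            qform su2Rep β ψ ψ * l2 (blockIter β ℓ 1 (Ψ 0)) (blockIter β ℓ 1 (Ψ 0))
              ≤ qform su2Rep β (blockIter β ℓ 1 (Ψ 0)) (blockIter β ℓ 1 (Ψ 0)) * l2 ψ ψ) ∧
        -- (b1) exact block-level Ritz family: the dressed vectors are l2-orthogonal AND P-orthogonal (block times 2 and 3 of the raw family)
        (∀ i j, i ≠ j → l2 (blockIter β ℓ 1 (Ψ i)) (blockIter β ℓ 1 (Ψ j)) = 0 ∧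
                          blockCorr β ℓ 1 (blockIter β ℓ 1 (Ψ i)) (blockIter β ℓ 1 (Ψ j)) = 0) ∧
        -- (b2) two-sided block Rayleigh match against the one-site levels to the ℓ-th power
        (∀ j, blockCorr β ℓ 1 (blockIter β ℓ 1 (Ψ j)) (blockIter β ℓ 1 (Ψ j))
                * l2 (blockIter β ℓ 1 (Ψ 0)) (blockIter β ℓ 1 (Ψ 0))
                * levelValue su2Rep 1 (oneSiteCoupling β L) 0 ^ ℓ
              ≤ Real.exp (C * luscherLambda β L ^ 2)
                * (blockCorr β ℓ 1 (blockIter β ℓ 1 (Ψ 0)) (blockIter β ℓ 1 (Ψ 0))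
                    * l2 (blockIter β ℓ 1 (Ψ j)) (blockIter β ℓ 1 (Ψ j))
                    * levelValue su2Rep 1 (oneSiteCoupling β L) j ^ ℓ) ∧
            blockCorr β ℓ 1 (blockIter β ℓ 1 (Ψ 0)) (blockIter β ℓ 1 (Ψ 0))
                * l2 (blockIter β ℓ 1 (Ψ j)) (blockIter β ℓ 1 (Ψ j))
                * levelValue su2Rep 1 (oneSiteCoupling β L) j ^ ℓ
              ≤ Real.exp (C * luscherLambda β L ^ 2)
                * (blockCorr β ℓ 1 (blockIter β ℓ 1 (Ψ j)) (blockIter β ℓ 1 (Ψ j))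
                    * l2 (blockIter β ℓ 1 (Ψ 0)) (blockIter β ℓ 1 (Ψ 0))
                    * levelValue su2Rep 1 (oneSiteCoupling β L) 0 ^ ℓ)) ∧
        -- (b3) block defects ≤ CΛ³ ≤ 1/8, undressed and once-dressed
        C * luscherLambda β L ^ 3 ≤ 1 / 8 ∧
        (∀ j, BlockDefectLE β ℓ (C * luscherLambda β L ^ 3) (Ψ j) ∧
              BlockDefectLE β ℓ (C * luscherLambda β L ^ 3) (blockIter β ℓ 1 (Ψ j)))

/-- **The block-aligned door** (M; spectral theory of `K = (K^ℓ)^{1/ℓ}` + exact Ritz rotation `exists_orthonormal_formDiagonal_antitone`):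
block-currency data ⇒ every clause of `DressedRitz` with the window CONTRACTED by `1/ℓ` (ratios) and `1/ℓ²` (residuals): per vector
`BlockToFine`; cross terms `CrossSecondOrder` (`O((Λ³+Λ^{5/2})/ℓ)`, below the `CΛ²/L` tolerance); then the fine Ritz rotation moves the
sorted values by at most the operator norm of the off-diagonal part within block-near clusters (Weyl — no non-degeneracy hypothesis on the
one-site levels) and by `‖r‖²/gap = O(Λ³/ℓ)` across `ℓ`-separated clusters (gap `≥ 0.13/ℓ` by definition; tree `ritz_near_diagonal`), and
residuals by `‖E‖²`; `Ω` decouples exactly (`qform(Ω,Ψ_i) = λ₀·l2(Ω,Ψ_i) = 0`). [folklore] -/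
def BlockDoor : Prop :=
  BlockPlateau → Summit.QuantumFields.YangMills.Theses.LuscherReduction.DressedRitz

/-- Trivial seam: the first lemma and the door compose with the transfer target to the crux BY NAME. [folklore] -/
theorem dressedRitz_of_blockPlateau (hDoor : BlockDoor) (hC : BlockPlateau) :
    Summit.QuantumFields.YangMills.Theses.LuscherReduction.DressedRitz :=
  hDoor hC

end Summit.QuantumFields.YangMills.Cruxes.DressedRitz.BlockEndpoint
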